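import Literature.Probability.RandomPlanarGeometry.SLERestrictionHitReduction
import Literature.Probability.RandomPlanarGeometry.SLERestrictionHitStolz
import HarnessLib

/-!
# Discharge of `IsSmoothHull.restrictionDerivVanishesAtHit` ([LSW] Lemma 6.3)

The named fact `IsSmoothHull.restrictionDerivVanishesAtHit` of
`Literature/Probability/RandomPlanarGeometry/SLERestrictionSmooth.lean` — G. F. Lawler, O. Schramm,
W. Werner, *Conformal restriction: the chordal case*, J. Amer. Math. Soc. **16** (2003) 917–955,
arXiv:math/0209343, **Lemma 6.3** (p. 14 of the arXiv version): for a continuous driving function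
`W` with Loewner maps `g_t` and hulls `K_t`, a smooth hull `A ∈ 𝒬*`, `T < ∞` the hitting time of
`A` with `K_T ∩ A ∩ ℝ = ∅`, and `A_t = g_t(A)`: `lim_{t ↗ T} Φ'_{A_t}(W_t) = 0` — is PROVED here
(`IsSmoothHull.restrictionDerivVanishesAtHit_holds`), closing the decomposition carried out in
this directory:

* `K_T ∩ A ⊂ ∂A` and the hit point (`LoewnerHullHitting`, `LoewnerHullHittingArc`);
* the smooth hit path and the access arc (`SmoothHitPathExists`, `AccessArc`), the limit
  `g_T(β x) - W_T → 0` (`SLERestrictionHitPathTendsto`) and the sector claim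
  (`SLERestrictionHitStolz`, by the quasi-geodesic argument of
  `Literature/Analysis/Complex/HalfPlaneQuasiGeodesic.lean` in place of the printed Brownian
  hitting estimate);
* the analytic substitute for the excursion step and Prop. 4.1 — the single-scale obstacle
  estimate for `Φ'` via Green's functions and its multi-scale iteration
  (`RestrictionDerivArcObstacle`, `RestrictionDerivMultiScale`) — and the assembly
  (`SLERestrictionHitChain` … `SLERestrictionHitFinal`, `SLERestrictionHitReduction`).

This file is a leaf (it is not imported by `SLERestrictionSmooth`, which states the fact).
-/

noncomputable section

namespace Literature.Probability.RandomPlanarGeometry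

/-- **[LSW] Lemma 6.3, proved**: the discharge `theorem X_holds : X` of the named fact
`IsSmoothHull.restrictionDerivVanishesAtHit` — `Φ'_{g_t(A)}(W_t) → 0` as `t ↗ T` when the Loewner
hull of a continuous driving function first hits a smooth `*`-hull `A` off the real line.
[cite: LawlerSchrammWerner2003Restriction, Lemma 6.3] -/
theorem IsSmoothHull.restrictionDerivVanishesAtHit_holds :
    IsSmoothHull.restrictionDerivVanishesAtHit :=
  restrictionDerivVanishesAtHit_of_stolz IsSmoothHull.hitPath_stolz_holds

end Literature.Probability.RandomPlanarGeometry
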